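import Mathlib
import HarnessLib
import HarnessLib.Audit
import Summits.CriticalPhenomena.Statement
import Literature.Probability.Percolation.CardyFormula
import Literature.Probability.Percolation.SmirnovTheorem
import Literature.Probability.Percolation.SmirnovContinuumLimit
import Literature.Barriers.CriticalPhenomena.CoveringLatticeShift
import HarnessLib.Audit.Status.Attr

/-!
Route: UnionJackBeffara

DORMANT since 2026-08-25T17:36:53Z (reconciler: no traction for 7.9 d (last activity item-evidence-added at 2026-08-17T19:19:43Z); parked, not closed — `ledger route dormant route-CriticalPhenomena-UnionJackBeffara --off` to reactivate) — unstaffed, not closed; items shared with open routes are served there. `ledger route dormant <id> --off` reactivates.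

# Route UnionJackBeffara — Smirnov's contour argument at second order on the centred square lattice,
then Beffara's flat q-interpolation down to bond-Z2

It suffices to show X = UnionJackCardy ∧ MixedInterpolation (card z4-protected-beffara-union-jack,
both legs). UnionJackCardy: critical SITE
percolation on Beffara's centred square lattice G_s (Union-Jack triangulation: ℤ² plus every face
centre joined to its four corners, p_c = 1/2,
law P_{1/2,1/2} = prodBernoulli (mixedParam half) of the tree's CoveringLatticeShift objects)
satisfies Cardy's formula for every conformal
rectangle, in the crude discretisation (open site path with all rescaled vertices in Ω, endpoints
within 2δ of the arcs (ab), (cd)).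
MixedInterpolation: along Beffara's mixed family P_{1/2,q} (type-I sites 1/2, type-II centres q,
type-III centres 1-q) the crossing
probability of every conformal rectangle at q = 1/2 and at q = 0 differ by o(1) as δ → 0⁺. Since
P_{1/2,0} on δG_s, in the covering-adapted
embedding used here (type-I sites = edge midpoints of δℤ², type-III centres = vertices of δℤ²,
type-II = face centres), IS Kesten's covering
encoding of bond percolation on δℤ² at p = 1/2, X plus a discretisation bridge (CoveringBridge)
gives CardyFormulaZ2. Leg (I) is reached
through the crux UnionJackMorera (Smirnov separating families exist on G_s) and the provable-now
transfer UnionJackEndgame.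
Lean: `let Z : Literature.Barriers.CriticalPhenomena.MixedSite → ℂ := fun v => Sum.elim (fun x : ℤ ×
ℤ => (((x.1 + x.2 : ℤ) : ℂ) + ((x.2 - x.1 + 1 : ℤ) : ℂ) * Complex.I) / 2) (fun f : ℤ × ℤ => (((f.1 +
f.2 + 1 : ℤ) : ℂ) + ((f.2 + 1 - f.1 : ℤ) : ℂ) * Complex.I) / 2) v; let G : SimpleGraph
Literature.Barriers.CriticalPhenomena.MixedSite := SimpleGraph.fromRel fun u v => ∃ x : ℤ × ℤ, u =
Sum.inl x ∧ (v = Sum.inl (x.1 + 1, x.2) ∨ v = Sum.inl (x.1, x.2 + 1) ∨ ∃ f : ℤ × ℤ, v = Sum.inr f ∧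
(x.1 = f.1 ∨ x.1 = f.1 + 1) ∧ (x.2 = f.2 ∨ x.2 = f.2 + 1)); let P : unitInterval →
Literature.Probability.RandomPlanarGeometry.ConformalRectangle → ℝ → ℝ := fun q R δ =>
(Literature.Probability.LatticeModels.prodBernoulli
(Literature.Barriers.CriticalPhenomena.mixedParam q)).real {ω | ∃ u v, Metric.infDist ((δ : ℂ) * Z
u) (R.arc 0) ≤ 2 * δ ∧ Metric.infDist ((δ : ℂ) * Z v) (R.arc 2) ≤ 2 * δ ∧ ω ∈
Literature.Probability.Percolation.siteConnIn G {y | (δ : ℂ) * Z y ∈ R.carrier} u v}; (∀ R :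
Literature.Probability.RandomPlanarGeometry.ConformalRectangle, R.HasCrossingLimit (P
Literature.Probability.Percolation.half R)
Literature.Probability.RandomPlanarGeometry.cardyFunction) ∧ ∀ R :
Literature.Probability.RandomPlanarGeometry.ConformalRectangle, Tendsto (fun δ => P
Literature.Probability.Percolation.half R δ - P 0 R δ) (𝓝[>] 0) (𝓝 0)`

## Assembly
Tendsto arithmetic, sorry-free in the planner's Sketch.lean: UnionJackEndgame applied to
UnionJackMorera gives UnionJackCardy (crude P_{1/2,1/2}
crossing → F(η) for every R and uniformizing datum); subtracting MixedInterpolation gives the same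
limit for the crude P_{1/2,0} crossing of every R;
CoveringBridge turns that global statement into R.HasCrossingLimit (bondDomainCrossingProb R)
cardyFunction for every R, i.e. CardyFormulaZ2
(root-level conjunct constant of Summits/CriticalPhenomena/CardyFormulaZ2/Statement.lean).

Rationale: WHY THIS LINE. Beffara2008Universal §3–§4 runs Smirnov's proof on any RSW triangulation: the
discrete contour integral of H_δ = H_A + τH_B + τ²H_C equals
Σ_e ψ(e) P_A(e) + o(1) (eq. (discr)), and ψ ≡ 0 iff the dual faces are equilateral (barrier
SmirnovTriangularOnly); on G_s colour switching is
EXACT (site triangulation, p = 1/2 self-matching, full D4 symmetry) but ψ ≠ 0, and Beffara's Prop.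
16 (Kesten1986 IIC ratio limits) kills only
the leading δ^(2/3) order, leaving an exactly marginal O(1) defect ("depends on the speed of
convergence", §4.2). The card's mechanism: posit the
level-one two-scale expansion (SE) of the six oriented 3-arm pattern probabilities
(Kesten/GarbanPeteSchramm2013 ratio-limit technology); then
the two exact covariances of (discr) — relabelling (A,B,C)→(B,C,A) and the quarter-turn of G_s —
leave the marginal functional only the form
β·∫∫∂̄h, so every subsequential limit is holomorphic unless β = 2i (NonVacuity), and the tree's
abstract Smirnov endgame (IsSmirnovFamily,
triangleIntegral_eq_zero_of_forall_lattice_holds, smirnov_claim24_holds, exists_isCarlesonMap_holds,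
all PROVED) gives Cardy on G_s. Leg (II) is
Beffara2008Universal §5 (Prop. 18: ∂_q P_{1/2,q}[U] = E|Piv∩V₂| − E|Piv∩V₃|) completed by a
selection rule: divergent class-odd orders of the
4-arm two-scale expansion are killed because |∫∂_qP dq| ≤ 1, the marginal δ^(3/4) term is the spin-2
(stress-tensor) response, which cannot
couple to a type-II/III centre fixed by a quarter-turn symmetry of P_{1/2,q} (tree:
mixedPi_map_mixedRotII). Imported areas: discrete
complex analysis (Smirnov/Beffara/BollobasRiordan2006 Ch. 7, whose T-version is proved in tree),
near-critical/IIC arm technology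
(Kesten1986, GarbanPeteSchramm2010, GarbanPeteSchramm2013, Nolin2008), lattice-symmetry selection
rules for corrections to scaling (physics
folklore, here as exact measure covariances). What prior routes do not do:
CardyHarmonicInvariants/CardyDiscreteHolo ask for Morera on ℤ²
itself where colour switching fails; CardyIsoradial transports inside the bond-isoradial class 𝒢,
which contains neither G_s-site nor
P_{1/2,q}; here Morera is attacked on the nearest lattice where switching is exact and the passage
to ℤ² is an interpolation, not a coupling.

RANKED CRUXES. #0 Target (target) — X = UnionJackCardy ∧ MixedInterpolation: Cardy's formula for
critical site percolation on the centred square lattice G_s (crude discretisation, all conformal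
rectangles) and flatness of Beffara's interpolation (P_{1/2,1/2} and P_{1/2,0} crossing
probabilities of every conformal rectangle differ by o(1)). (why it might fail: true unless
universality fails for G_s-site or along P_{1/2,q}; as a PROOF it dies if β = 2i (leg I vacuous) or
if a class-odd spin-0/4k correction of gap ≤ 3/4 exists in the 4-arm sector (leg II); G_s Cardy
alone is Grimmett2018 §5.7's 'principal open problem'.) [Beffara2008Universal, Grimmett2018,
Schramm2007ICM, Smirnov2001]
#2 UnionJackMorera (crux) — leg (I) deliverable (card K1+K2 folded into Smirnov's discrete half):
for every conformal rectangle R with a Carleson datum (abc equilateral, d ∈ (c,a), ψ : Ω → Δ with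
boundary values a,b,c,d at the marks) there are δ₀ > 0 and two Smirnov separating families gm, gp
(tree structure IsSmirnovFamily: continuous [0,1]-valued, uniformly equicontinuous, every
subsequential uniform limit satisfies the contour relation (36) on lattice-parallel equilateral
triangles and the boundary values (37)) sandwiching the crude P_{1/2,1/2} site-crossing probability
of R on δG_s up to e(δ) → 0 at points zm, zp → d' — the exact G_s analogue of the PROVED triangular
fact smirnov_exists_separatingFamilies. The families are the (interpolated) G_s separating
probabilities H^δ_α of inner/outer approximating domains; (36) is where ψ ≠ 0 bites and where (SE) +
β ≠ 2i + the relabelling/quarter-turn covariances of (discr) are to be used. [difficulty: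
open-problem] (why it might fail: ψ(e) = ((√3−3)/2)e^(iπ/3) ≠ 0 on T_s, so Σψ(e)P_A(e) ≍ δ^(-1/3)
before cancellation; (36) for subsequential limits needs the level-one expansion (SE) AND β ≠ 2i —
and β = 2i is exactly how a non-conformal subsequential limit would hide (Beffara §4.2).)
[Beffara2008Universal, Beffara2007, BollobasRiordan2006, Smirnov2009CriticalPercolation, Kesten1986,
GarbanPeteSchramm2013, KohlerSchindlerTassion2023, Grimmett2018]
#3 MixedInterpolation (crux) — leg (II) (card K3): for every conformal rectangle R, the crude
crossing probability of R on δG_s under P_{1/2,1/2} minus that under P_{1/2,0} tends to 0 as δ → 0⁺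
(Beffara's ∫₀^(1/2) ∂_q P_{1/2,q}[U] dq → 0; Prop. 18 generalised Russo formula, 4-arm two-scale
expansion, boundedness in q, and the spin-2 selection rule at type-II/III centres from the
quarter-turn symmetry mixedPi_map_mixedRotII valid for every q). [difficulty: XL] (why it might
fail: needs ∂_qP_{1/2,q}[U] → 0 uniformly in q — Beffara's missing estimate (location dependence of
P[v∈Piv], §5.2); boundedness kills divergent class-odd orders only in q-average, and the marginal
δ^(3/4) term is killed modulo NoMarginal4 (no class-odd spin-0/4k correction of gap ≤ 3/4).)
[Beffara2008Universal, KestenPTM1982, SmirnovWerner2001, GarbanPeteSchramm2010, Nolin2008,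
Literature.Barriers.CriticalPhenomena.CoveringLatticeShiftNarrow]
#4 CoveringBridge (crux) — Kesten's covering graph + discretisation robustness on ℤ²: if the crude
P_{1/2,0} crossing probability on δG_s converges to Cardy's F(η) for EVERY conformal rectangle, then
G02's bondDomainCrossingProb R δ (bond-ℤ² at 1/2, largest component Ω_δ, discrete arcs) converges to
F(η) for every R. In the embedding used, P_{1/2,0}-open clusters of δG_s meeting a type-I site are
exactly the open bond clusters of δℤ² (type-III vertices open a.s., type-II face centres closed
a.s.), so the content is a Bollobás–Riordan Lemma-14 sandwich of Ω_δ between crude crossings of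
inner/outer approximating conformal rectangles plus continuity of F∘η in the domain (tree template:
tri_exists_discreteApprox_proof). [difficulty: L] (why it might fail: crude events check vertices
not edges (G_s paths need midpoints in Ω, bond paths may jump thin fjords); for fat (Osgood) Jordan
boundaries 'largest component = bulk' is unproved in tree (MeshDomainBulk proviso volume(∂Ω)=0), so
the sandwich must use smooth approximants and continuity of F.) [KestenPTM1982,
Beffara2008Universal, BollobasRiordan2006, Grimmett2018, stmt-CriticalPhenomena-0787]
#9 UnionJackEndgame (support) — UnionJackMorera → UnionJackCardy: Smirnov families sandwiching the
crude G_s crossing probability force it to converge to Carleson's ratio, hence (Carleson maps exist,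
Cardy–Carleson identity) to cardyFunction(η) for every uniformizing datum. Verbatim copy of the
tree's smirnov_tendsto_triDomainCrossingProb_of_limitArgument +
hasCrossingLimit_triDomainCrossingProb_of_carleson with the proved facts
triangleIntegral_eq_zero_of_forall_lattice_holds, smirnov_claim24_holds, exists_isCarlesonMap_holds,
cardyFunction_crossRatio_eq_carlesonRatio_holds. [difficulty: provable-now] [BollobasRiordan2006,
Smirnov2001, Beffara2007]

TWO-LAYER PLAN. Foreseen glued split of UnionJackMorera once the definition requests land (k = 3,
depth 1): UnionJackMorera ⇐ LevelOneExpansion → NonVacuity →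
DiscrIdentityUJ → UnionJackMorera, where LevelOneExpansion (card K1, SE) = level-one two-scale
expansion P_A(e) = δ^(2/3) π m_A(z) + δ Σ_X ⟨β^X_e, ∇h_X(z)⟩ + o(δ)
of the six oriented 3-arm pattern probabilities of the 4.8.8 dual T_s, uniformly on compacts, for
every subsequential limit (h_A,h_B,h_C) with C¹
interior regularity; NonVacuity (card K2) = the resulting constant β(G_s) ≠ 2i (RSW-level two-sided
bounds on the polarisation constants
β^X_e, not their values); DiscrIdentityUJ = Beffara's (discr) on G_s with explicit o(1) bookkeeping
+ RSW/Hölder/boundary-value fields of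
IsSmirnovFamily (BollobasRiordan2006 Claims 22–23 transplanted; RSW on G_s via
KohlerSchindlerTassion2023 Thm 1/Comment 1 from self-matching
+ D4 symmetry). Foreseen split of MixedInterpolation: FourArmExpansion (two-scale expansion of P_q[v
∈ Piv(U)] with class-independent divergent
coefficients) → NoMarginal4 (no class-odd spin-0/4k correction of relative order δ^(3/4)) →
MixedInterpolation. Foreseen split of CoveringBridge:
CoveringIdentity (exact Kesten dictionary at fixed δ in the bulk) → ZdLemma14 (inner/outer
approximating conformal rectangles for bond-ℤ², B–R
Lemma 14 with (19)) → CoveringBridge. Nothing here is filed now.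

KILL CRITERIA. A kit/Monte-Carlo or transfer-matrix measurement showing the crude G_s-site crossing
limit of one rectangle differs from Cardy (¬UnionJackCardy)
refutes Target, UnionJackMorera and percolation universality at once — close
`refuted:UnionJackMorera` (sensational either way). β(G_s) = 2i
within certified error (NonVacuity false) kills leg (I) AS A PROOF but not UnionJackMorera: pivot
the split to another source of (36) (e.g. the
fallback 'limits are conformally invariant impostors F_λ' + CardyRigidity of route CardyUniqueLimit
transplanted to G_s) or close `exhausted`.
¬MixedInterpolation (a plateau of E|Piv∩V₂|−E|Piv∩V₃| at some q) refutes leg (II) and Beffara's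
programme; the route then survives only as
'Cardy on G_s' (a Literature-grade result, not the conjunct) — close `refuted:MixedInterpolation`.
¬CoveringBridge would mean G02's
discreteCrossing and the crude event differ in the limit on ℤ²: report to operator (statement
hygiene), route blocked not dead. CardyFormulaZ2
proved by any other route moots this one; UnionJackCardy stays of independent interest.

NOT DECOMPOSED YET. The objects of (SE): G_s separating probabilities H^δ_α, oriented-edge 3-arm
pattern probabilities P_A(e) on T_s, their polarisation constants
β^X_e and β — definition requests filed, children of UnionJackMorera later. RSW / Hölder /
boundary-value inputs on G_s (routine, inside the
DiscrIdentityUJ child). The 4-arm two-scale expansion, NoMarginal4 and the uniform-in-q Russo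
bookkeeping (children of MixedInterpolation). The
exact covering dictionary at fixed δ and the ℤ² Lemma-14 approximating domains (children of
CoveringBridge). A Goursat-type lemma 'contours
along the G_s directions 1, i suffice' (the G_s analogue of the tree's (M)
triangleIntegral_eq_zero_of_forall_lattice, which is phrased for
ζ-parallel equilateral triangles as IsSmirnovFamily.limit_contour demands) sits inside
UnionJackMorera's proof, not as an item. The explicit
numbers ψ(e), Σ_P B_b b̄ (card) are not items. No third layer will be filed: helper lemmas ride with
--supports.

CHEAPEST FALSIFIER. kit compute (not run here: plancard seat, no kit in payload): (a) crude
site-crossing probability of the 2:1 and 3:1 rectangles on G_s at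
p = 1/2, meshes 1/64…1/1024 — must approach Cardy's values F(η(r)), r = 2, 3 (Cardy1992;
cardyFunction of the rectangle's cross-ratio; the
square gives exactly 1/2 at every δ by self-matching + D4 and carries no information); a certified
deviation kills UnionJackCardy and the route; (b) the card's test (a): fit the δ-linear term of the
six P_A(e) against ∇ of the Cardy–Carleson harmonic
functions in an equilateral domain and assemble β: β within error of 2i kills leg (I) as a proof;
(c) E|Piv∩V₂| − E|Piv∩V₃| for a 2:1 rectangle at
q ∈ {0.1, 0.25, 0.4}, meshes 1/64…1/512, must → 0 (a plateau kills MixedInterpolation). Lookup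
already done: no G_s/Union-Jack Cardy theorem or
counter-claim in print (searches in Novelty); Zhang arXiv:2206.04599 (unrefereed) concerns site
percolation on a sheared lattice N_δ, not G_s.

NUMBERS. ψ(e) = ((√3−3)/2)·e^(iπ/3) for the balanced embedding of T_s, ψ(τ.e) = τ²ψ(e) (card); 3-arm
exponent 2/3 and 4-arm exponent 5/4 on T
(SmirnovWerner2001) give the orders δ^(2/3) (leading, killed by Prop. 16), δ^(2/3+1/3) = δ
(marginal) in leg (I) and δ^(5/4)·δ^(-2) = δ^(-3/4)
(divergent), relative δ^(3/4) (marginal, spin 2) in leg (II); Beffara's heuristic Δ(v) ≈ δ^(9/4) >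
δ² (§5.2). Square crossing of G_s-site at
1/2 is exactly 1/2 at every mesh (self-matching + quarter-turn). Items at open: 6 (target, 3 cruxes,
1 support, assembly).

DEFINITION REQUESTS. (1) unionJackGraph : SimpleGraph MixedSite, unionJackEmbed : MixedSite → ℂ (the
covering-adapted embedding inlined by `let` in every decl above)
and ujCrossingProb q R δ (crude crossing probability under prodBernoulli (mixedParam q)) — topic
Literature/Probability/Percolation, so that the
route decls can be re-signed without the let-blobs. (2) UJ separating probabilities ujSepProb (T :
MarkedDomain 3) δ i z and Beffara's
oriented-edge pattern probabilities ujEdgePatternProb on the 4.8.8 dual (faces of the Union-Jack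
triangulation = (face, side) pairs), modelled
on the tree's TriMarkedDomain.sepEvent / armEvent — needed to type LevelOneExpansion, NonVacuity,
DiscrIdentityUJ. Filed with
`ledger workitem add --kind definition` right after open.

Novelty: Searches (2026-08-15): `lit frontier CriticalPhenomena --since 2022` (30 rows; none on G_s /
Beffara's second order / mixed percolation);
`lit bridges CriticalPhenomena --cross any`; `lit galaxy search "centered square lattice
percolation" --star all` (0 hits; a second galaxy query
queued out); `lit search --source crossref "Beffara critical percolation universal mixed percolation
centred square lattice Cardy"` (14:
Beffara2008Universal = doi:10.1007/978-3-7643-8786-0_3, Wierman 1984 doi:10.1017/s0021900200024657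
mixed SITE-BOND model = different object,
Beffara–Nolin doi:10.1214/10-aop581); `lit search --source s2 "Union Jack lattice site percolation
crossing probability conformal invariance"`
(7: Smirnov2001, arXiv:0909.4499, Camia–Newman, Chayes–Lei 2006, N. Sun survey);
openalex/arxiv/zbmath rate-limited (429/0); `lit read
arXiv:2206.04599` pp. 1–4 (Zhang: sheared lattice N_δ, not G_s); tree: barrier files
SmirnovTriangularOnly, CoveringLatticeShift(+Narrow),
EmbeddingModulusUniqueness; the card's own crossref/arXiv/galaxy queries and its refuter audit
(grade new-combination, 2026-08-15).
Nearest prior art found: Beffara2008Universal (arXiv:0708.3908) §3 eq. (discr), §4.1–4.2 (Prop. 16: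
ratio limits kill the leading order;
'depends on the speed of convergence'), §2.2 (α_(T_s) = i by the order-4 symmetry), §5 (mixed
percolation P_{1/2,q}, Prop. 18, 'what is missing')
— the scaffold, first order only; Kesten1986 / GarbanPeteSchramm2013 (ratio-limit technology);
Grimmett2018  [refs: 10.1007/978-3-7643-8786-0_3, 10.1017/s0021900200024657, 10.1214/10-aop581, 0909.4499, 2206.04599, 0708.3908, doi:10.1007/978-3-7643-8786-0_3, doi:10.1017/s0021900200024657, doi:10.1214/10-aop581, Smirnov2001, Kesten1986, GarbanPeteSchramm2013, Grimmett2018]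

Barriers (technique_class: contour-identity two-scale-expansion selection-rules): - technique_class: contour-identity two-scale-expansion selection-rules
- Literature.Barriers.CriticalPhenomena.SmirnovTriangularOnly: met head-on, not evaded — ψ ≠ 0 on
T_s is computed and carried; the barrier's printed loophole (Beffara §4: emerging cancellations /
tune the speed of convergence) is exactly what UnionJackMorera's foreseen children (SE, β ≠ 2i)
complete; the bet is that the marginal term is covariance-constrained to β∂̄h.
- Literature.Barriers.CriticalPhenomena.CoveringLatticeShift: leg (II) never pairs a type-II site
with a type-III site along a type-exchanging symmetry; it uses only the residual index-2 group valid
for every q (face-centre quarter-turn mixedPi_map_mixedRotII, even translations, flip∘shift) — the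
NOT-blocked class (a)/(b) of CoveringLatticeShiftNarrow — plus a RATE statement for the label
dependence, which no conjunct constrains; conditional on NoMarginal4, stated openly.
- Literature.Barriers.CriticalPhenomena.EmbeddingModulusUniqueness: consistent — every input of leg
(I) sees the embedding (ψ, the Euclidean quarter-turn of the embedded G_s); for a sheared copy the
same bookkeeping outputs a constant-coefficient Beltrami equation, i.e. conformal invariance in
exactly one linear image, as the barrier demands.
- Literature.Barriers.CriticalPhenomena.FKParafermionicHalfCauchyRiemann: not in the technique class
— no parafermionic/FK observable; Smirnov's three separating probabilities on a genuine
triangulation with exact colour switching (Smi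

History (route lifecycle, newest last):
- 2026-08-25T17:36:53Z · DORMANT — reconciler: no traction for 7.9 d (last activity item-evidence-added at 2026-08-17T19:19:43Z); parked, not closed — `ledger route dormant route-CriticalPhenomen (operator:999:2750498)

sub-problem: CardyFormulaZ2 · status: dormant · opened planner-plancard-CriticalPhenomena-CardyFormu-2d1eb823-0 2026-08-15T11:34:31Z · rev 9 · ledger route-CriticalPhenomena-UnionJackBeffara
GENERATED by the gate from the ledger (D-0016/17). Provers cite these decls: `theorem foo : Summit.CriticalPhenomena.CardyFormulaZ2.Theses.UnionJackBeffara.<Decl> := …` in Summits/CriticalPhenomena/CardyFormulaZ2/Theorems/<Name>.lean.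
-/

namespace Summit.CriticalPhenomena.CardyFormulaZ2.Theses.UnionJackBeffara

open scoped BigOperators Topology Manifold Classical MeasureTheory ProbabilityTheory Matrix InnerProductSpace ComplexConjugate ContinuousMap
open Filter Set Function TopologicalSpace MeasureTheory

attribute [summit_statement] _root_.CardyFormulaZ2

/-- item stmt-CriticalPhenomena-4557 · target · rank 0 · open · by planner
why it might fail: true unless universality fails for G_s-site or along P_{1/2,q}; as a PROOF it dies if β = 2i (leg I vacuous) or if a class-odd spin-0/4k correction of gap ≤ 3/4 exists in the 4-arm sector (leg II); G_s Cardy alone is Grimmett2018 §5.7's 'principal open problem'.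
sources: Beffara2008Universal, Grimmett2018, Schramm2007ICM, Smirnov2001
[target] X = UnionJackCardy ∧ MixedInterpolation: Cardy's formula for critical site percolation on
the centred square lattice G_s (crude discretisation, all conformal rectangles) and flatness of
Beffara's interpolation (P_{1/2,1/2} and P_{1/2,0} crossing probabilities of every conformal
rectangle differ by o(1)). -/
@[route_item "route-CriticalPhenomena-UnionJackBeffara"]
def Target : Prop :=
  let Z : Literature.Barriers.CriticalPhenomena.MixedSite → ℂ := fun v => Sum.elim (fun x : ℤ × ℤ => (((x.1 + x.2 : ℤ) : ℂ) + ((x.2 - x.1 + 1 : ℤ) : ℂ) * Complex.I) / 2) (fun f : ℤ × ℤ => (((f.1 + f.2 + 1 : ℤ) : ℂ) + ((f.2 + 1 - f.1 : ℤ) : ℂ) * Complex.I) / 2) v; let G : SimpleGraph Literature.Barriers.CriticalPhenomena.MixedSite := SimpleGraph.fromRel fun u v => ∃ x : ℤ × ℤ, u = Sum.inl x ∧ (v = Sum.inl (x.1 + 1, x.2) ∨ v = Sum.inl (x.1, x.2 + 1) ∨ ∃ f : ℤ × ℤ, v = Sum.inr f ∧ (x.1 = f.1 ∨ x.1 = f.1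 + 1) ∧ (x.2 = f.2 ∨ x.2 = f.2 + 1)); let P : unitInterval → Literature.Probability.RandomPlanarGeometry.ConformalRectangle → ℝ → ℝ := fun q R δ => (Literature.Probability.LatticeModels.prodBernoulli (Literature.Barriers.CriticalPhenomena.mixedParam q)).real {ω | ∃ u v, Metric.infDist ((δ : ℂ) * Z u) (R.arc 0) ≤ 2 * δ ∧ Metric.infDist ((δ : ℂ) * Z v) (R.arc 2) ≤ 2 * δ ∧ ω ∈ Literature.Probability.Percolation.siteConnIn G {y | (δ : ℂ) * Z y ∈ R.carrier} u v}; (∀ R : Literature.Probability.RandomPlanarGeometry.ConformalRectangle, R.HasCrossingLimit (P Literature.Probability.Percolation.half R) Literature.Probability.RandomPlanarGeometry.cardyFunction) ∧ ∀ R : Literature.Probability.RandomPlanarGeometry.ConformalRectangle, Tendsto (fun δ => P Literature.Probability.Percolation.half R δ - P 0 R δ) (𝓝[>] 0) (𝓝 0)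

/-- item stmt-CriticalPhenomena-4558 · crux · rank 2 · open · by planner
why it might fail: ψ(e) = ((√3−3)/2)e^(iπ/3) ≠ 0 on T_s, so Σψ(e)P_A(e) ≍ δ^(-1/3) before cancellation; (36) for subsequential limits needs the level-one expansion (SE) AND β ≠ 2i — and β = 2i is exactly how a non-conformal subsequential limit would hide (Beffara §4.2).
sources: Beffara2008Universal, Beffara2007, BollobasRiordan2006, Smirnov2009CriticalPercolation, Kesten1986, GarbanPeteSchramm2013
[crux] leg (I) deliverable (card K1+K2 folded into Smirnov's discrete half): for every conformal
rectangle R with a Carleson datum (abc equilateral, d ∈ (c,a), ψ : Ω → Δ with boundary values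
a,b,c,d at the marks) there are δ₀ > 0 and two Smirnov separating families gm, gp (tree structure
IsSmirnovFamily: continuous [0,1]-valued, uniformly equicontinuous, every subsequential uniform
limit satisfies the contour relation (36) on lattice-parallel equilateral triangles and the boundary
values (37)) sandwiching the crude P_{1/2,1/2} site-crossing probability of R on δG_s up to e(δ) → 0
at points zm, zp → d' — the exact G_s analogue of the PROVED triangular fact
smirnov_exists_separatingFamilies. The families are the (interpolated) G_s separating probabilities
H^δ_α of inner/outer approximating domains; (36) is where ψ ≠ 0 bites and where (SE) + β ≠ 2i + the
relabelling/quarter-turn covariances of (discr) are to be used. [difficulty: open-problem] -/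
@[route_item "route-CriticalPhenomena-UnionJackBeffara", crux]
def UnionJackMorera : Prop :=
  let Z : Literature.Barriers.CriticalPhenomena.MixedSite → ℂ := fun v => Sum.elim (fun x : ℤ × ℤ => (((x.1 + x.2 : ℤ) : ℂ) + ((x.2 - x.1 + 1 : ℤ) : ℂ) * Complex.I) / 2) (fun f : ℤ × ℤ => (((f.1 + f.2 + 1 : ℤ) : ℂ) + ((f.2 + 1 - f.1 : ℤ) : ℂ) * Complex.I) / 2) v; let G : SimpleGraph Literature.Barriers.CriticalPhenomena.MixedSite := SimpleGraph.fromRel fun u v => ∃ x : ℤ × ℤ, u = Sum.inl x ∧ (v = Sum.inl (x.1 + 1, x.2) ∨ v = Sum.inl (x.1, x.2 + 1) ∨ ∃ f : ℤ × ℤ, v = Sum.inr f ∧ (x.1 = f.1 ∨ x.1 = f.1 + 1) ∧ (x.2 = f.2 ∨ x.2 = f.2 + 1)); let P : unitInterval → Literature.Probability.RandomPlanarGeometry.ConformalRectangle → ℝ → ℝ := fun q R δ => (Literature.Probability.LatticeModels.prodBernoulli (Literature.Barriers.CriticalPhenomena.mixedParam q)).real {ω | ∃ u v, Metric.infDist ((δ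 : ℂ) * Z u) (R.arc 0) ≤ 2 * δ ∧ Metric.infDist ((δ : ℂ) * Z v) (R.arc 2) ≤ 2 * δ ∧ ω ∈ Literature.Probability.Percolation.siteConnIn G {y | (δ : ℂ) * Z y ∈ R.carrier} u v}; ∀ (R : Literature.Probability.RandomPlanarGeometry.ConformalRectangle) (a b c d : ℂ) (ψ : Literature.Probability.RandomPlanarGeometry.ConformalEquiv R.carrier (Literature.Probability.Percolation.openTriangle a b c)), Literature.Probability.Percolation.IsEquilateral a b c → d ∈ openSegment ℝ c a → Literature.Probability.Percolation.IsCarlesonMap R a b c d ψ → ∃ δ₀ > (0 : ℝ), ∃ gm gp : ℝ → Fin 3 → ℂ → ℝ, Literature.Probability.Percolation.IsSmirnovFamily R a b c δ₀ gm ∧ Literature.Probability.Percolation.IsSmirnovFamily R a b c δ₀ gp ∧ ∃ (zm zp : ℝ → ℂ) (e : ℝ → ℝ), (∀ δ ∈ Set.Ioo 0 δ₀, zm δ ∈ R.carrier ∧ zp δ ∈ R.carrier) ∧ Tendsto zm (𝓝[>] 0) (𝓝 (R.pt 3)) ∧ Tendsto zp (𝓝[>] 0) (𝓝 (R.pt 3))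 ∧ Tendsto e (𝓝[>] 0) (𝓝 0) ∧ ∀ δ ∈ Set.Ioo 0 δ₀, gm δ 1 (zm δ) - e δ ≤ P Literature.Probability.Percolation.half R δ ∧ P Literature.Probability.Percolation.half R δ ≤ gp δ 1 (zp δ) + e δ

/-- item stmt-CriticalPhenomena-4559 · crux · rank 3 · open · by planner
why it might fail: needs ∂_qP_{1/2,q}[U] → 0 uniformly in q — Beffara's missing estimate (location dependence of P[v∈Piv], §5.2); boundedness kills divergent class-odd orders only in q-average, and the marginal δ^(3/4) term is killed modulo NoMarginal4 (no class-odd spin-0/4k correction of gap ≤ 3/4).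
sources: Beffara2008Universal, KestenPTM1982, SmirnovWerner2001, GarbanPeteSchramm2010, Nolin2008, Literature.Barriers.CriticalPhenomena.CoveringLatticeShiftNarrow
[crux] leg (II) (card K3): for every conformal rectangle R, the crude crossing probability of R on
δG_s under P_{1/2,1/2} minus that under P_{1/2,0} tends to 0 as δ → 0⁺ (Beffara's ∫₀^(1/2) ∂_q
P_{1/2,q}[U] dq → 0; Prop. 18 generalised Russo formula, 4-arm two-scale expansion, boundedness in
q, and the spin-2 selection rule at type-II/III centres from the quarter-turn symmetry
mixedPi_map_mixedRotII valid for every q). [difficulty: XL] -/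
@[route_item "route-CriticalPhenomena-UnionJackBeffara", crux]
def MixedInterpolation : Prop :=
  let Z : Literature.Barriers.CriticalPhenomena.MixedSite → ℂ := fun v => Sum.elim (fun x : ℤ × ℤ => (((x.1 + x.2 : ℤ) : ℂ) + ((x.2 - x.1 + 1 : ℤ) : ℂ) * Complex.I) / 2) (fun f : ℤ × ℤ => (((f.1 + f.2 + 1 : ℤ) : ℂ) + ((f.2 + 1 - f.1 : ℤ) : ℂ) * Complex.I) / 2) v; let G : SimpleGraph Literature.Barriers.CriticalPhenomena.MixedSite := SimpleGraph.fromRel fun u v => ∃ x : ℤ × ℤ, u = Sum.inl x ∧ (v = Sum.inl (x.1 + 1, x.2) ∨ v = Sum.inl (x.1, x.2 + 1) ∨ ∃ f : ℤ × ℤ, v = Sum.inr f ∧ (x.1 = f.1 ∨ x.1 = f.1 + 1) ∧ (x.2 = f.2 ∨ x.2 = f.2 + 1)); let P : unitInterval → Literature.Probability.RandomPlanarGeometry.ConformalRectangle → ℝ → ℝ := fun q R δ => (Literature.Probability.LatticeModels.prodBernoulli (Literature.Barriers.CriticalPhenomena.mixedParam q)).real {ω | ∃ u v, Metric.infDist ((δ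 : ℂ) * Z u) (R.arc 0) ≤ 2 * δ ∧ Metric.infDist ((δ : ℂ) * Z v) (R.arc 2) ≤ 2 * δ ∧ ω ∈ Literature.Probability.Percolation.siteConnIn G {y | (δ : ℂ) * Z y ∈ R.carrier} u v}; ∀ R : Literature.Probability.RandomPlanarGeometry.ConformalRectangle, Tendsto (fun δ => P Literature.Probability.Percolation.half R δ - P 0 R δ) (𝓝[>] 0) (𝓝 0)

/-- item stmt-CriticalPhenomena-4560 · crux · rank 4 · closed · proved by Summit.CriticalPhenomena.CardyFormulaZ2.Theorems.coveringBridge_proof @ 511481cb7c86 (prover) · by planner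
why it might fail: crude events check vertices not edges (G_s paths need midpoints in Ω, bond paths may jump thin fjords); for fat (Osgood) Jordan boundaries 'largest component = bulk' is unproved in tree (MeshDomainBulk proviso volume(∂Ω)=0), so the sandwich must use smooth approximants and continuity of F.
sources: KestenPTM1982, Beffara2008Universal, BollobasRiordan2006, Grimmett2018, stmt-CriticalPhenomena-0787
[crux] Kesten's covering graph + discretisation robustness on ℤ²: if the crude P_{1/2,0} crossing
probability on δG_s converges to Cardy's F(η) for EVERY conformal rectangle, then G02's
bondDomainCrossingProb R δ (bond-ℤ² at 1/2, largest component Ω_δ, discrete arcs) converges to F(η)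
for every R. In the embedding used, P_{1/2,0}-open clusters of δG_s meeting a type-I site are
exactly the open bond clusters of δℤ² (type-III vertices open a.s., type-II face centres closed
a.s.), so the content is a Bollobás–Riordan Lemma-14 sandwich of Ω_δ between crude crossings of
inner/outer approximating conformal rectangles plus continuity of F∘η in the domain (tree template:
tri_exists_discreteApprox_proof). [difficulty: L] -/
@[route_item "route-CriticalPhenomena-UnionJackBeffara", crux]
def CoveringBridge : Prop :=
  let Z : Literature.Barriers.CriticalPhenomena.MixedSite → ℂ := fun v => Sum.elim (fun x : ℤ × ℤ => (((x.1 + x.2 : ℤ) : ℂ) + ((x.2 - x.1 + 1 : ℤ) : ℂ) * Complex.I) / 2) (fun f : ℤ × ℤ => (((f.1 + f.2 + 1 : ℤ) : ℂ) + ((f.2 + 1 - f.1 : ℤ) : ℂ) * Complex.I) / 2) v; let G : SimpleGraph Literature.Barriers.CriticalPhenomena.MixedSite := SimpleGraph.fromRel fun u v => ∃ x : ℤ × ℤ, u = Sum.inl x ∧ (v = Sum.inl (x.1 + 1, x.2) ∨ v = Sum.inl (x.1, x.2 + 1) ∨ ∃ f : ℤ × ℤ, v = Sum.inr f ∧ (x.1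 = f.1 ∨ x.1 = f.1 + 1) ∧ (x.2 = f.2 ∨ x.2 = f.2 + 1)); let P : unitInterval → Literature.Probability.RandomPlanarGeometry.ConformalRectangle → ℝ → ℝ := fun q R δ => (Literature.Probability.LatticeModels.prodBernoulli (Literature.Barriers.CriticalPhenomena.mixedParam q)).real {ω | ∃ u v, Metric.infDist ((δ : ℂ) * Z u) (R.arc 0) ≤ 2 * δ ∧ Metric.infDist ((δ : ℂ) * Z v) (R.arc 2) ≤ 2 * δ ∧ ω ∈ Literature.Probability.Percolation.siteConnIn G {y | (δ : ℂ) * Z y ∈ R.carrier} u v}; (∀ R : Literature.Probability.RandomPlanarGeometry.ConformalRectangle, R.HasCrossingLimit (P 0 R) Literature.Probability.RandomPlanarGeometry.cardyFunction) → ∀ R : Literature.Probability.RandomPlanarGeometry.ConformalRectangle, R.HasCrossingLimit (Literature.Probability.Percolation.bondDomainCrossingProb R) Literature.Probability.RandomPlanarGeometry.cardyFunction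

/-- item stmt-CriticalPhenomena-4561 · support · rank 9 · closed · proved by Summit.CriticalPhenomena.CardyFormulaZ2.Theorems.unionJackEndgame_proof (prover) · by planner
sources: BollobasRiordan2006, Smirnov2001, Beffara2007
[support] UnionJackMorera → UnionJackCardy: Smirnov families sandwiching the crude G_s crossing
probability force it to converge to Carleson's ratio, hence (Carleson maps exist, Cardy–Carleson
identity) to cardyFunction(η) for every uniformizing datum. Verbatim copy of the tree's
smirnov_tendsto_triDomainCrossingProb_of_limitArgument +
hasCrossingLimit_triDomainCrossingProb_of_carleson with the proved facts
triangleIntegral_eq_zero_of_forall_lattice_holds, smirnov_claim24_holds, exists_isCarlesonMap_holds,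
cardyFunction_crossRatio_eq_carlesonRatio_holds. [difficulty: provable-now] -/
@[route_item "route-CriticalPhenomena-UnionJackBeffara", crux]
def UnionJackEndgame : Prop :=
  let Z : Literature.Barriers.CriticalPhenomena.MixedSite → ℂ := fun v => Sum.elim (fun x : ℤ × ℤ => (((x.1 + x.2 : ℤ) : ℂ) + ((x.2 - x.1 + 1 : ℤ) : ℂ) * Complex.I) / 2) (fun f : ℤ × ℤ => (((f.1 + f.2 + 1 : ℤ) : ℂ) + ((f.2 + 1 - f.1 : ℤ) : ℂ) * Complex.I) / 2) v; let G : SimpleGraph Literature.Barriers.CriticalPhenomena.MixedSite := SimpleGraph.fromRel fun u v => ∃ x : ℤ × ℤ, u = Sum.inl x ∧ (v = Sum.inl (x.1 + 1, x.2) ∨ v = Sum.inl (x.1, x.2 + 1) ∨ ∃ f : ℤ × ℤ, v = Sum.inr f ∧ (x.1 = f.1 ∨ x.1 = f.1 + 1) ∧ (x.2 = f.2 ∨ x.2 = f.2 + 1)); let P : unitInterval → Literature.Probability.RandomPlanarGeometry.ConformalRectangle → ℝ → ℝ := fun q R δ => (Literature.Probability.LatticeModels.prodBernoulli (Literature.Barriers.CriticalPhenomena.mixedParam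 q)).real {ω | ∃ u v, Metric.infDist ((δ : ℂ) * Z u) (R.arc 0) ≤ 2 * δ ∧ Metric.infDist ((δ : ℂ) * Z v) (R.arc 2) ≤ 2 * δ ∧ ω ∈ Literature.Probability.Percolation.siteConnIn G {y | (δ : ℂ) * Z y ∈ R.carrier} u v}; (∀ (R : Literature.Probability.RandomPlanarGeometry.ConformalRectangle) (a b c d : ℂ) (ψ : Literature.Probability.RandomPlanarGeometry.ConformalEquiv R.carrier (Literature.Probability.Percolation.openTriangle a b c)), Literature.Probability.Percolation.IsEquilateral a b c → d ∈ openSegment ℝ c a → Literature.Probability.Percolation.IsCarlesonMap R a b c d ψ → ∃ δ₀ > (0 : ℝ), ∃ gm gp : ℝ → Fin 3 → ℂ → ℝ, Literature.Probability.Percolation.IsSmirnovFamily R a b c δ₀ gm ∧ Literature.Probability.Percolation.IsSmirnovFamily R a b c δ₀ gp ∧ ∃ (zm zp : ℝ → ℂ) (e : ℝ → ℝ), (∀ δ ∈ Set.Ioo 0 δ₀, zm δ ∈ R.carrier ∧ zp δ ∈ R.carrier) ∧ Tendsto zm (𝓝[>] 0) (𝓝 (R.pt 3)) ∧ Tendsto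 zp (𝓝[>] 0) (𝓝 (R.pt 3)) ∧ Tendsto e (𝓝[>] 0) (𝓝 0) ∧ ∀ δ ∈ Set.Ioo 0 δ₀, gm δ 1 (zm δ) - e δ ≤ P Literature.Probability.Percolation.half R δ ∧ P Literature.Probability.Percolation.half R δ ≤ gp δ 1 (zp δ) + e δ) → ∀ R : Literature.Probability.RandomPlanarGeometry.ConformalRectangle, R.HasCrossingLimit (P Literature.Probability.Percolation.half R) Literature.Probability.RandomPlanarGeometry.cardyFunction

/-- item stmt-CriticalPhenomena-14386 · support · rank 10 · closed · proved by Summit.CriticalPhenomena.CardyFormulaZ2.Theorems.unionJackBeffara_legsGiveTarget_proof @ 1d05a6b05952 (prover) · by planner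
sources: Beffara2008Universal, Smirnov2001, BollobasRiordan2006
[support] glue to the thesis (target reachability): leg (I) — UnionJackEndgame applied to
UnionJackMorera is the first conjunct of Target (Cardy's formula for the crude P_{1/2,1/2} site
crossing of every conformal rectangle on δG_s) — and leg (II) MixedInterpolation, the second
conjunct verbatim, give X = Target. Pure logic over the route's own decls: `fun hE hM hI => ⟨hE hM,
hI⟩` (planner Sketch2.lean, sorry-free). Rank 10 on purpose: the gate renders items by (kind, rank,
id), so a rank-9 copy (stmt-CriticalPhenomena-14164) lands before UnionJackEndgame and is blocked as
a forward reference. [deps: UnionJackEndgame, UnionJackMorera, MixedInterpolation, Target]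
[difficulty: provable-now] -/
@[route_item "route-CriticalPhenomena-UnionJackBeffara"]
def LegsGiveTarget : Prop :=
  UnionJackEndgame → UnionJackMorera → MixedInterpolation → Target

/-- item stmt-CriticalPhenomena-4562 · assembly · rank 1 · closed · proved by Summit.CriticalPhenomena.CardyFormulaZ2.Theorems.unionJackBeffara_assembly_proof (prover) · by planner
sources: Beffara2008Universal, Smirnov2001, BollobasRiordan2006
[assembly] UnionJackMorera → UnionJackEndgame → MixedInterpolation → CoveringBridge →
CardyFormulaZ2. -/
@[route_item "route-CriticalPhenomena-UnionJackBeffara"]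
def Assembly : Prop :=
  UnionJackMorera → UnionJackEndgame → MixedInterpolation → CoveringBridge → CardyFormulaZ2

-- records of items no longer active in this route (dropped / restated):
-- earlier TargetOfLegs (stmt-CriticalPhenomena-14164, replaced 2026-08-16T03:22:22Z -> stmt-CriticalPhenomena-14399): retired by None — UnionJackMorera → UnionJackEndgame → MixedInterpolation → Target

/-! D-0027 §2.1 — DECIDING THEOREM (planner-authored via `route open/edit --closes-file`; by planner-rrepair-CriticalPhenomena-UnionJackBef-42edeb4a-g2-0 2026-08-15T16:53:25Z):
its hypotheses are this route's items and its conclusion the sub-problem Statement (glue_lint), and it elaborates with this file. -/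

@[closes "route-CriticalPhenomena-UnionJackBeffara"] theorem closes (hM : UnionJackMorera) (hE : UnionJackEndgame) (hI : MixedInterpolation)
    (hB : CoveringBridge) : _root_.CardyFormulaZ2 := by
  apply hB
  intro R φ x hx
  have h1 := hE hM R φ x hx
  have h2 := hI R
  have h3 := h1.sub h2
  simp only [sub_sub_cancel, sub_zero] at h3
  exact h3

end Summit.CriticalPhenomena.CardyFormulaZ2.Theses.UnionJackBeffara
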